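import Literature.NumberTheory.Automorphic.UnitaryGroupCotangentSpectralProjection
import Literature.NumberTheory.Automorphic.AutomorphicConjugate
import Mathlib.Analysis.InnerProductSpace.Projection.Submodule
import HarnessLib

/-!
# The complex conjugate of a discrete automorphic representation, its orthogonal projection, and the ANTIHOLOMORPHIC spectral
# projection letter (D̄) from the holomorphic one (D)

Topic `NumberTheory/Automorphic`; namespaces `Literature.NumberTheory.Automorphic.AdelicGroupData` (one `L²` identity),
`Literature.NumberTheory.Automorphic.DiscreteAutomorphicRep` (`conj`), `Literature.NumberTheory.Automorphic.UnitaryGroup.CotangentForms`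
(the junction with the cotangent-form carriers of ★ `UnitaryGroupCohomologicalForms` and the letters of ★
`UnitaryGroupCotangentSpectralProjection`).  ONE definition with body (`DiscreteAutomorphicRep.conj`), theorems otherwise; no named
fact, no instance, no `sorry`.  Everything is PROVED over the tree's ★ `AutomorphicConjugate` (complex conjugation `conjL2 = star` on
`L²(G(𝔸)/A_G G(K), μ)`, `R(g) f̄ = \overline{R(g) f}`, the conjugate `W.conj` of a closed subrepresentation, irreducibility invariance).

WHY.  The floor-0 engine letters (D) `holCotFormSpectralProjection` and (D̄) `antiholCotFormSpectralProjection` (statement-only, ★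
`UnitaryGroupCotangentSpectralProjection`; consumed by the crux-`H413` folds of programmes P2 (U2′, U2a) and P3 (S3∕S4∕S5) of the
Hodge-CM cell) are exchanged by COMPLEX CONJUGATION: `f ↦ f̄` is a conjugate-linear isometry of `L²` commuting with right translations
([BorelJacquet1979, §4.6]), so it carries a discrete automorphic `P` to a discrete automorphic `P̄` and intertwines the orthogonal
projections, `pr_P (f̄) = \overline{pr_{P̄} (f)}`; and a `ℂ²`-valued form `Φ` is an antiholomorphic cotangent form iff `Φ̄` (componentwise,
`conjFun`) is a holomorphic one ([BorelWallach2000, VII 2.10]: complex conjugation exchanges the `(1,0)` and `(0,1)` summands).  Hence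
**(D) for all `P` implies (D̄) for all `P`** (apply (D) to `P̄` and `Φ̄`), and conversely: the two sockets are ONE.

* §1 `AdelicGroupData.L2.inner_star_star` — `⟪f̄, ḡ⟫ = ⟪g, f⟫` in `L²`.
* §2 `DiscreteAutomorphicRep.conj P = P̄` (+ `conj_space`, `mem_conj_space_iff`, `conj_conj`), and
  `DiscreteAutomorphicRep.starProjection_star` — `pr_P (star x) = star (pr_{P̄} x)`.
* §3 `CotangentForms.containsForm_conjFun_iff` (`P ∋ Φ̄ ↔ P̄ ∋ Φ`), `isAntiholCotangentAt_iff_conj` ∕ `isHolCotangentAt_iff_conj`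
  (`P` is of Hodge type `(0,1)` iff `P̄` is of type `(1,0)`), and the folds `antiholCotFormSpectralProjection_of_hol : (D) → (D̄)`,
  `holCotFormSpectralProjection_of_antihol : (D̄) → (D)`, `holCotFormSpectralProjection_iff_antihol`.

## References
* [BorelJacquet1979] A. Borel, H. Jacquet, *Automorphic forms and automorphic representations*, PSPM 33.1 (1979), §4.6.
* [BorelWallach2000] A. Borel, N. Wallach, *Continuous cohomology, discrete subgroups, and representations of reductive groups*, 2nd ed.
  (2000), VII 2.10, 3.2.
* [Bump1997] D. Bump, *Automorphic forms and representations* (1997), proof of Thm. 3.6.1, p. 342 (equivariance of `pr_P`).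
-/

noncomputable section

open scoped InnerProductSpace
open MeasureTheory NumberField

/-! ## §1  `⟪f̄, ḡ⟫ = ⟪g, f⟫` on `L²` of the automorphic quotient -/

namespace Literature.NumberTheory.Automorphic

namespace AdelicGroupData

universe u

variable {K : Type} [Field K] [NumberField K] (𝒢 : AdelicGroupData.{u} K) (μ : Measure 𝒢.automorphicQuotient)

/-- **`⟪f̄, ḡ⟫ = ⟪g, f⟫`** in `L²(G(𝔸_K) ⧸ A_G G(K), μ)`: complex conjugation is anti-unitary (pointwise `⟪z̄, w̄⟫ = ⟪w, z⟫` in `ℂ`, then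
`L2.inner_def`; complex conjugation is an anti-unitary operator on `L²`). [cite: BorelJacquet1979, §4.6] -/
theorem L2.inner_star_star (f g : 𝒢.L2 μ) : ⟪(star f : 𝒢.L2 μ), star g⟫_ℂ = ⟪g, f⟫_ℂ := by
  rw [MeasureTheory.L2.inner_def, MeasureTheory.L2.inner_def]
  refine integral_congr_ae ?_
  filter_upwards [Lp.coeFn_star f, Lp.coeFn_star g] with a ha hb
  rw [ha, hb]
  simp only [Pi.star_apply, RCLike.star_def, RCLike.inner_apply, RCLike.conj_conj]
  rw [mul_comm]

end AdelicGroupData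

/-! ## §2  The complex conjugate `P̄` of a discrete automorphic representation and its orthogonal projection -/

namespace DiscreteAutomorphicRep

open ContRepresentation

universe u

variable {K : Type} [Field K] [NumberField K] {𝒢 : AdelicGroupData.{u} K} {μ : Measure 𝒢.automorphicQuotient}
  [SMulInvariantMeasure 𝒢.Adelic 𝒢.automorphicQuotient μ]

/-- **The complex conjugate `P̄ = {f̄ : f ∈ P}` of a discrete automorphic representation `P ≤ L²(G(𝔸_K) ⧸ A_G G(K), μ)`**: a closed
`G(𝔸_K)`-invariant topologically irreducible subspace again (★ `ClosedSubrep.conj`, ★ `isTopIrreducible_conj_iff`: conjugation is a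
conjugate-linear isometry commuting with `R(g)`).  As an abstract representation `P̄` is the complex conjugate of `P`, i.e. (unitarity)
its contragredient. [cite: BorelJacquet1979, §4.6] -/
def conj (P : DiscreteAutomorphicRep 𝒢 μ) : DiscreteAutomorphicRep 𝒢 μ where
  space := P.space.conj
  irreducible := P.space.isTopIrreducible_conj_iff.mpr P.irreducible

/-- The space of `P̄` is `P.space.conj` (definitional). [cite: BorelJacquet1979, §4.6] -/
@[simp] theorem conj_space (P : DiscreteAutomorphicRep 𝒢 μ) : P.conj.space = P.space.conj := rfl

/-- `f ∈ P̄ ↔ f̄ ∈ P`. [cite: BorelJacquet1979, §4.6] -/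
theorem mem_conj_space_iff (P : DiscreteAutomorphicRep 𝒢 μ) {f : 𝒢.L2 μ} : f ∈ P.conj.space ↔ star f ∈ P.space :=
  P.space.mem_conj_iff

/-- `f̄ ∈ P̄` for `f ∈ P`. [cite: BorelJacquet1979, §4.6] -/
theorem star_mem_conj_space (P : DiscreteAutomorphicRep 𝒢 μ) {f : 𝒢.L2 μ} (hf : f ∈ P.space) : star f ∈ P.conj.space :=
  P.space.star_mem_conj hf

/-- `conj (conj P) = P` (complex conjugation is an involution). [cite: BorelJacquet1979, §4.6] -/
@[simp] theorem conj_conj (P : DiscreteAutomorphicRep 𝒢 μ) : P.conj.conj = P := by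
  cases P with
  | mk space irreducible =>
    simp only [conj, ClosedSubrep.conj_conj]

/-- **The orthogonal projections onto `P` and `P̄` are conjugate: `pr_P (f̄) = \overline{pr_{P̄} (f)}`.**  Indeed `\overline{pr_{P̄} f} ∈ P` and
`f̄ − \overline{pr_{P̄} f} = \overline{f − pr_{P̄} f}` is orthogonal to `P` because `⟪u, z̄⟫ = ⟪z, ū⟫` and `ū ∈ P̄` for `u ∈ P` (Mathlib
`Submodule.eq_starProjection_of_mem_orthogonal`). [cite: Bump1997, proof of Thm. 3.6.1 (p. 342)] -/
theorem starProjection_star (P : DiscreteAutomorphicRep 𝒢 μ) (x : 𝒢.L2 μ) :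
    P.space.toSubmodule.starProjection (star x) = star (P.conj.space.toSubmodule.starProjection x) := by
  refine Submodule.eq_starProjection_of_mem_orthogonal ?_ ?_
  · exact (P.mem_conj_space_iff).mp (P.conj.space.toSubmodule.starProjection_apply_mem x)
  · have hsub : star x - star (P.conj.space.toSubmodule.starProjection x) =
        star (x - P.conj.space.toSubmodule.starProjection x) :=
      (map_sub (𝒢.conjL2 μ) x _).symm
    rw [hsub, Submodule.mem_orthogonal]
    intro u hu
    have h0 : ⟪(star u : 𝒢.L2 μ), x - P.conj.space.toSubmodule.starProjection x⟫_ℂ = 0 :=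
      (Submodule.mem_orthogonal _ _).mp (P.conj.space.toSubmodule.sub_starProjection_mem_orthogonal x) (star u)
        (P.star_mem_conj_space hu)
    calc ⟪u, star (x - P.conj.space.toSubmodule.starProjection x)⟫_ℂ
        = ⟪star (star u : 𝒢.L2 μ), star (x - P.conj.space.toSubmodule.starProjection x)⟫_ℂ := by rw [star_star]
      _ = ⟪x - P.conj.space.toSubmodule.starProjection x, star u⟫_ℂ := AdelicGroupData.L2.inner_star_star 𝒢 μ _ _
      _ = 0 := by rw [inner_eq_zero_symm]; exact h0

end DiscreteAutomorphicRep

/-! ## §3  The cotangent-form junction: `P ∋ Φ̄ ↔ P̄ ∋ Φ`, Hodge types `(0,1) ↔ (1,0)` under `P ↦ P̄`, and (D) ⟺ (D̄) -/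

namespace UnitaryGroup.CotangentForms

open Literature.Geometry.ComplexHyperbolic.BallModel (U21)

section Junction

variable {F E : Type} [Field F] [NumberField F] [Field E] [NumberField E] [Algebra F E]
  {c : E ≃ₐ[F] E} {N : ℕ} {J : Matrix (Fin N) (Fin N) E}
  {μ : Measure (adelicGroupData F E c N J).automorphicQuotient}
  [SMulInvariantMeasure (adelicGroupData F E c N J).Adelic (adelicGroupData F E c N J).automorphicQuotient μ]

/-- Reading a coordinate of the componentwise conjugate `Φ̄` on the quotient gives the conjugate function (definitional: `toQuotFun` evaluates at
a chosen representative). [cite: BorelWallach2000, VII 2.10] -/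
theorem toQuotFun_conjFun (Φ : (adelicGroupData F E c N J).Adelic → (Fin 2 → ℂ)) (j : Fin 2) :
    (toQuotFun (adelicGroupData F E c N J) fun g => conjFun F E c N J Φ g j) =
      star (toQuotFun (adelicGroupData F E c N J) fun g => Φ g j) := rfl

/-- **`P` contains `Φ̄` iff `P̄` contains `Φ`** (the classes of the coordinates of `Φ̄` are the conjugates of those of `Φ`, ★ `conjL2_toLp`).
[cite: BorelJacquet1979, §4.6] -/
theorem containsForm_conjFun_iff (P : DiscreteAutomorphicRep (adelicGroupData F E c N J) μ)
    (Φ : (adelicGroupData F E c N J).Adelic → (Fin 2 → ℂ)) :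
    P.ContainsForm (conjFun F E c N J Φ) ↔ P.conj.ContainsForm Φ := by
  constructor
  · intro h j
    obtain ⟨hm, hmem⟩ := h j
    have hm' : MemLp (toQuotFun (adelicGroupData F E c N J) fun g => Φ g j) 2 μ := by
      have h' := hm.star
      rw [toQuotFun_conjFun, star_star] at h'
      exact h'
    have e : hm.toLp _ = star (hm'.toLp _) := by
      rw [← AdelicGroupData.conjL2_apply, AdelicGroupData.conjL2_toLp]
      rfl
    refine ⟨hm', (P.mem_conj_space_iff).mpr ?_⟩
    rw [← e]
    exact hmem
  · intro h j
    obtain ⟨hm', hmem⟩ := h j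
    have hm : MemLp (toQuotFun (adelicGroupData F E c N J) fun g => conjFun F E c N J Φ g j) 2 μ := by
      rw [toQuotFun_conjFun]
      exact hm'.star
    have e : hm.toLp _ = star (hm'.toLp _) := by
      rw [← AdelicGroupData.conjL2_apply, AdelicGroupData.conjL2_toLp]
      rfl
    refine ⟨hm, ?_⟩
    rw [e]
    exact (P.mem_conj_space_iff).mp hmem

/-- `Φ̄ = 0 ↔ Φ = 0` (componentwise complex conjugation is injective). [cite: BorelWallach2000, VII 2.10] -/
theorem conjFun_eq_zero_iff (Φ : (adelicGroupData F E c N J).Adelic → (Fin 2 → ℂ)) : conjFun F E c N J Φ = 0 ↔ Φ = 0 := by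
  constructor
  · intro h
    funext x
    have := congrFun h x
    rw [conjFun_apply, Pi.zero_apply, star_eq_zero] at this
    exact this
  · rintro rfl
    exact map_zero _

/-- `\overline{Φ̄} = Φ` (componentwise complex conjugation is an involution). [cite: BorelWallach2000, VII 2.10] -/
theorem conjFun_conjFun (Φ : (adelicGroupData F E c N J).Adelic → (Fin 2 → ℂ)) : conjFun F E c N J (conjFun F E c N J Φ) = Φ := by
  funext x
  rw [conjFun_apply, conjFun_apply, star_star]

/-- **`P` is of Hodge type `(0,1)` iff `P̄` is of Hodge type `(1,0)`**: `P` contains a non-zero antiholomorphic cotangent form `Φ̄` iff `P̄` contains the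
non-zero holomorphic cotangent form `Φ`. [cite: BorelWallach2000, VII 2.10 and 3.2] -/
theorem isAntiholCotangentAt_iff_conj (P : DiscreteAutomorphicRep (adelicGroupData F E c N J) μ)
    (ιinf : U21 →* (adelicGroupData F E c N J).Adelic) (Kc : Subgroup (adelicGroupData F E c N J).Adelic) :
    P.IsAntiholCotangentAt ιinf Kc ↔ P.conj.IsHolCotangentAt ιinf Kc := by
  constructor
  · rintro ⟨Φ, hΦ, hΦ0, hP⟩
    obtain ⟨Φ₀, hΦ₀, rfl⟩ := Submodule.mem_map.mp hΦ
    exact ⟨Φ₀, hΦ₀, fun h => hΦ0 (by rw [h, map_zero]), (containsForm_conjFun_iff P Φ₀).mp hP⟩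
  · rintro ⟨Φ₀, hΦ₀, hΦ0, hP⟩
    exact ⟨conjFun F E c N J Φ₀, Submodule.mem_map_of_mem hΦ₀, fun h => hΦ0 ((conjFun_eq_zero_iff Φ₀).mp h),
      (containsForm_conjFun_iff P Φ₀).mpr hP⟩

/-- **`P` is of Hodge type `(1,0)` iff `P̄` is of Hodge type `(0,1)`.** [cite: BorelWallach2000, VII 2.10 and 3.2] -/
theorem isHolCotangentAt_iff_conj (P : DiscreteAutomorphicRep (adelicGroupData F E c N J) μ)
    (ιinf : U21 →* (adelicGroupData F E c N J).Adelic) (Kc : Subgroup (adelicGroupData F E c N J).Adelic) :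
    P.IsHolCotangentAt ιinf Kc ↔ P.conj.IsAntiholCotangentAt ιinf Kc := by
  rw [isAntiholCotangentAt_iff_conj, DiscreteAutomorphicRep.conj_conj]

end Junction

/-- **(D) ⟹ (D̄): the spectral projection of an ANTIholomorphic cotangent form is antiholomorphic, GIVEN the holomorphic letter.**  For
`Φ = Φ̄₀` with `Φ₀ ∈ holCotForms`: `pr_P [Φ·j] = pr_P \overline{[Φ₀·j]} = \overline{pr_{P̄} [Φ₀·j]} = \overline{[Ψ₀·j]} = [Ψ̄₀·j]` with `Ψ₀` the holomorphic
cotangent form that (D) provides for `P̄` and `Φ₀`. [cite: BorelJacquet1979, §4.6] [cite: BorelWallach2000, VII 2.10] -/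
theorem antiholCotFormSpectralProjection_of_hol (hD : holCotFormSpectralProjection) : antiholCotFormSpectralProjection := by
  intro L _ _ _ ι H T hT hpos h2 μ _ P Φ hΦmem hΦ
  obtain ⟨Φ₀, hΦ₀, rfl⟩ := Submodule.mem_map.mp hΦmem
  have hΦ₀L : ∀ j : Fin 2,
      MemLp (toQuotFun (adelicGroupData (↥(maximalRealSubfield L)) L (IsCMField.complexConj L) 3 H) fun g => Φ₀ g j) 2 μ := by
    intro j
    have h := (hΦ j).star
    rw [toQuotFun_conjFun, star_star] at h
    exact h
  obtain ⟨Ψ₀, hΨ₀, hΨ₀L, heq⟩ := hD L ι H T hT hpos h2 μ P.conj Φ₀ hΦ₀ hΦ₀L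
  have hΨL : ∀ j : Fin 2,
      MemLp (toQuotFun (adelicGroupData (↥(maximalRealSubfield L)) L (IsCMField.complexConj L) 3 H) fun g =>
        conjFun (↥(maximalRealSubfield L)) L (IsCMField.complexConj L) 3 H Ψ₀ g j) 2 μ := by
    intro j
    rw [toQuotFun_conjFun]
    exact (hΨ₀L j).star
  refine ⟨conjFun (↥(maximalRealSubfield L)) L (IsCMField.complexConj L) 3 H Ψ₀, Submodule.mem_map_of_mem hΨ₀, hΨL, fun j => ?_⟩
  have e1 : (hΦ j).toLp _ = star ((hΦ₀L j).toLp _) := by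
    rw [← AdelicGroupData.conjL2_apply, AdelicGroupData.conjL2_toLp]
    rfl
  have e2 : (hΨL j).toLp _ = star ((hΨ₀L j).toLp _) := by
    rw [← AdelicGroupData.conjL2_apply, AdelicGroupData.conjL2_toLp]
    rfl
  rw [e1, DiscreteAutomorphicRep.starProjection_star, heq j, e2]

/-- **(D̄) ⟹ (D)**, by the same conjugation applied to `P̄` and `Φ̄` (`\overline{P̄} = P`, `\overline{Φ̄} = Φ`). [cite: BorelJacquet1979, §4.6] [cite: BorelWallach2000, VII 2.10] -/
theorem holCotFormSpectralProjection_of_antihol (hD' : antiholCotFormSpectralProjection) : holCotFormSpectralProjection := by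
  intro L _ _ _ ι H T hT hpos h2 μ _ P Φ₀ hΦ₀ hΦ₀L
  have hΦL : ∀ j : Fin 2,
      MemLp (toQuotFun (adelicGroupData (↥(maximalRealSubfield L)) L (IsCMField.complexConj L) 3 H) fun g =>
        conjFun (↥(maximalRealSubfield L)) L (IsCMField.complexConj L) 3 H Φ₀ g j) 2 μ := by
    intro j
    rw [toQuotFun_conjFun]
    exact (hΦ₀L j).star
  obtain ⟨Ψ, hΨmem, hΨL, heq⟩ := hD' L ι H T hT hpos h2 μ P.conj _ (Submodule.mem_map_of_mem hΦ₀) hΦL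
  obtain ⟨Ψ₀, hΨ₀, rfl⟩ := Submodule.mem_map.mp hΨmem
  have hΨ₀L : ∀ j : Fin 2,
      MemLp (toQuotFun (adelicGroupData (↥(maximalRealSubfield L)) L (IsCMField.complexConj L) 3 H) fun g => Ψ₀ g j) 2 μ := by
    intro j
    have h := (hΨL j).star
    rw [toQuotFun_conjFun, star_star] at h
    exact h
  refine ⟨Ψ₀, hΨ₀, hΨ₀L, fun j => ?_⟩
  have e1 : (hΦL j).toLp _ = star ((hΦ₀L j).toLp _) := by
    rw [← AdelicGroupData.conjL2_apply, AdelicGroupData.conjL2_toLp]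
    rfl
  have e2 : (hΨL j).toLp _ = star ((hΨ₀L j).toLp _) := by
    rw [← AdelicGroupData.conjL2_apply, AdelicGroupData.conjL2_toLp]
    rfl
  -- conjugate the identity for `P̄`: `pr_{P̄} [Φ̄₀·j] = [Ψ̄₀·j]` ⟹ `pr_P [Φ₀·j] = [Ψ₀·j]`
  have key := heq j
  rw [e1, e2, ← P.conj_conj, DiscreteAutomorphicRep.starProjection_star, DiscreteAutomorphicRep.conj_conj, star_inj] at key
  rw [P.conj_conj] at key
  exact key

/-- **(D) ⟺ (D̄)**: the holomorphic and antiholomorphic spectral-projection letters are ONE socket. [cite: BorelJacquet1979, §4.6] [cite: BorelWallach2000, VII 2.10] -/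
theorem holCotFormSpectralProjection_iff_antihol : holCotFormSpectralProjection ↔ antiholCotFormSpectralProjection :=
  ⟨antiholCotFormSpectralProjection_of_hol, holCotFormSpectralProjection_of_antihol⟩

end UnitaryGroup.CotangentForms

end Literature.NumberTheory.Automorphic

end
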